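import Summits.BirchSwinnertonDyer.Rank1Residual.O5.HeegnerLogTransportThreeStepZeroEndRecord
import Summits.BirchSwinnertonDyer.Rank1Residual.O5.HeegnerLogTransportThreeIsoCurrency
import HarnessLib
import HarnessLib.Audit.Tags

/-!
# O5 (t′) Heegner-log transport at `p = 3` — part 21: the END of record (`…_cited_s0e`) in ISO / X3E currency

HONEST FRAMING (cell `b2b-bsdres`; seat o5-r2 = O5 planner 2, NON-Iwasawa side): research route; O5
(tame additive potentially supersingular at `3`, twist view (t′)) is OPEN; these are CONDITIONAL
theorems (published inputs displayed as labelled hypotheses BY NAME); census = EVIDENCE, never a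
Literature fact; nothing booked; no mark / label / count / tier of the RESIDUAL-MAP moves. THEOREMS
ONLY (3 corollaries, 0 def, 0 fact, no `sorry`), tree inputs by name.

WHAT. Part 18's END of record `o5_index_unit_of_ordinary_companion_cited_s0e`
(`O5/HeegnerLogTransportThreeStepZeroEndRecord.lean`; conclusion `3 ∤ [W(K) : ℤ·P]`) with its one
non-finitary per-pair binder `hcong` (the trace congruence at EVERY prime `ℓ ∤ 3 N_W N_G`) REPLACED,
via part 20 (`O5/HeegnerLogTransportThreeIsoCurrency.lean`), by: `hT : TorsionIso G W 3` (`…_s0e_iso`);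
ONE direct X3E row `(l m u : ℚ) (hu) (h4) (h6)` (`…_s0e_x3e`, the companion relation then a pair of
`norm_num` identities resting on NO fact); one reverse row (`…_s0e_x3eRev`). Every other binder, and
the displayed facts (A314 Kriz–Li 1.16, Poitou–Tate, local EP, Yan–Zhu 4.15, Wuthrich L20,
modularity, GZK), verbatim. The o5-r2 GEN 24 census table
`b2b-bsdres-o5-r2/gen24/census/KL3-X3E-certs-o5r2-g24.tsv` supplies `(kind, l, m, u)` for all 870 KL3
census pairs (274 / 274 with a good-ordinary companion). The `htamGd'`-free sibling (`…_s0f`, harvest-2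
E116′ `O5/HeegnerTwistTamagawaThree.lean`) takes the same three-line treatment (harvest-2's MINE).

Placement note for the O5 typer (cc-typer-5): new leaf over part 18 file 2 + part 20; namespace
`…O5.HeegnerLogTransport`; farm check (merged with part 20 while it is unplaced) rc 0 / 0 warnings /
0 sorries; `#print axioms …_cited_s0e_x3eRev` = {propext, Classical.choice, Quot.sound}.

## TYPER PLACEMENT NOTE (cc-typer-5 GEN 20 = O5 §3.5 / O6 §3.4 typer of record; by-name ask A-O5-G24-1 of o5-r2 GEN 24, HOME/INBOX.md l.14533 (1):
'place PART 20 → PART 20b → PART 21 as new leaves (no node touched)'; order of record 20 → 20b → 21; memo `HOME/b2b-bsdres-o5-r2/gen24/O5-GEN24.md` cd5acd5f2d83ffec)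

Source: `HOME/b2b-bsdres-o5-r2/gen24/lean/HeegnerLogTransportThreeStepZeroEndIso.lean` sha16 `04d039866f5ea1a6` (209 l.; `gen24/SHA16.txt`; o5-r2's check with part 18 file 2's body INLINED byte-identically
(its olean was unbuilt on the farm at 06:42Z / 06:58Z) + part 20: `gen24/lean/scratch/scratch_part20_21_f2inlined.lean` 0be24e5155a98966 rc 0 / 0 err / 0 warn / 0 sorry,
`#print axioms …_s0e_x3eRev`, `…_s0e_iso` standard), re-hashed by the typer right before writing; THIS file = KL3 part 21 = the source VERBATIM + this paragraph (imports,
module text, every declaration block byte-identical; script `class-closure/typer-5/gen20/g24_place.py`); placed AFTER part 18 file 2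
`O5/HeegnerLogTransportThreeStepZeroEndRecord.lean` (p355323) and part 20 `O5/HeegnerLogTransportThreeIsoCurrency.lean` (p356385), both this seat's placements and in the
tree; the typer's own STANDALONE farm check on the TREE imports (file 2's olean built; rc 0 / 0 warnings, `#print axioms` of the three corollaries std) and DEDUP
(`lean search --decl` on the 3 new names: no match) precede the proposal.
CONTENT LABELS (source, unchanged): THEOREMS ONLY (3 corollaries) — 0 `def`, 0 `@[conjecture]`, 0 Literature facts (net named-fact debt 0), no `sorry`; published inputs
stay displayed hypotheses BY NAME (A314 Kriz–Li Thm. 1.16, Poitou–Tate, local EP, Yan–Zhu 4.15, Wuthrich L20, modularity, GZK — exactly the END of record's); tree theorems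
reused BY NAME (file 2's END `o5_index_unit_of_ordinary_companion_cited_s0e`, part 20's `isCongruentModThree_of_torsionIso / _of_hesseCertificate / _of_dualHesseCertificate`),
nothing re-proved; ENDs OF RECORD after this file: `o5_index_unit_of_ordinary_companion_cited_s0e_iso / _s0e_x3e / _s0e_x3eRev` (the `htamGd'`-free `_cited_s0f` siblings
are harvest-2's, A-O5-G24-2).
KL3 parts in the tree: 1–3 p340741 / p341262 / p341640 (part 1 doc restamp p353140), Global p342632, OrdCompanion p343587 + p344465, OrdSelmer p345030 + p345686,
OrdTwist p346273, Residual Engine p347366 + Residual p348865 + End p350277, BaseSelmer p349318, ExactCount p349954, GoodSelmer p350559, TameTamagawa p350983,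
RatLogUnit p351404, ResidualEndFacts p352109, BaseSelmerCount p352220, KrizLiGlue p352538, StepZero p352755, ShaDescent p352972, CitedEnd p353868, StepZeroEnd
p354679 + StepZeroEndRecord p355323, IsoCurrency p356385; E116′ `O5/HeegnerTwistTamagawaThree.lean` p354556 (harvest-2); Literature: index lemma p344022,
A314 p350088, Kraus–Oesterlé Prop. 3 (i)⇒(iii) proofs p354819 (n1011-lit).  [Part 20b `O5/HeegnerLogTransportThreeIsoCurrencyRows.lean` FILED p356989 (kind definition —
four curve literals — review-queued D-0009 at this writing; not an import of this file); harvest-2's `_cited_s0f` leaf `O5/HeegnerLogTransportThreeStepZeroEndAnyDiscr.lean`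
p356092 (not an import of this file).]
HONEST FRAMING (cell `b2b-bsdres`): research route, lane CLASS-CLOSURE §3.5 O5; CONDITIONAL theorems — nothing asserted beyond the displayed binders, nothing booked,
no mark of `RESIDUAL-MAP.md` moves; census = EVIDENCE, never a Literature fact; O5 OPEN.
-/

noncomputable section

open scoped Classical NumberField

open IsDedekindDomain Field WeierstrassCurve Literature.NumberTheory.EllipticCurves
  Literature.NumberTheory.EllipticCurves.ModularForms
  Literature.NumberTheory.EllipticCurves.Rank1Residual
  Literature.NumberTheory.EllipticCurves.Rank1Residual.Typed
  Literature.NumberTheory.GaloisRepresentations Rat.HeightOneSpectrum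
open Literature.NumberTheory.EllipticCurves.Fisher2012 (hesseC4three hesseC6three hesseD3)
open Summit.BirchSwinnertonDyer.Rank1Residual.X1.CongruenceTransfer (TorsionIso)
open Summit.BirchSwinnertonDyer.Rank1Residual.X11b (embAt)
open Literature.NumberTheory.GaloisCohomology (poitouTate_selmerStructure_duality)

set_option autoImplicit false

namespace Summit.BirchSwinnertonDyer.Rank1Residual.O5.HeegnerLogTransport

/-- **O5 (t′) END OF RECORD (`…_cited_s0e`, part 18) in ISO CURRENCY**: the congruence binder `hcong`
(`a_ℓ(W) ≡ a_ℓ(G) (mod 3)` at every `ℓ ∤ 3 N_W N_G`) REPLACED by the cell's currency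
`hT : TorsionIso G W 3` (part 20 `isCongruentModThree_of_torsionIso` = Kraus–Oesterlé Prop. 3 (i)⇒(iii),
proved in the tree); every other binder verbatim, same displayed facts. [cite: KrizLi2019, Thm. 1.16, Rem. 1.17 (FMS 7 (2019) e15)]
[cite: KrausOesterle1992, Prop. 3 (i) ⇒ (iii) (pp. 262–263)] -/
theorem o5_index_unit_of_ordinary_companion_cited_s0e_iso
    (hKL : KrizLi2019.thm116_padicLogHeegner_congruence)
    (hPT : ∀ (K : Type) [Field K] [NumberField K], poitouTate_selmerStructure_duality K)
    (hEP : ∀ (K : Type) [Field K] [NumberField K] (v : HeightOneSpectrum (𝓞 K)),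
      localEulerPoincareCharacteristic (v.adicCompletion K))
    (hYZ : YanZhu2026.thm415_padicValRat_bsd_rank_le_one)
    (hW20 : Wuthrich2014.lemma20_surjective_threeAdic_of_semistable)
    (hmod : exists_isNewformOf) (hGZK : rank_eq_analyticRank_of_analyticRank_le_one)
    (W G : WeierstrassCurve ℚ) [W.IsElliptic] [W.IsGloballyMinimal] [G.IsElliptic] [G.IsGloballyMinimal]
    (hT : TorsionIso G W 3)
    (hρ : W.HasSurjectiveModNGaloisRep 3) (hadd : Addv W 3) (ht3 : NoLocalThreeTorsionAt W 3)
    (htℓ : ∀ (ℓ : ℕ) [Fact ℓ.Prime], ℓ ≠ 3 → (ℓ : ℤ) ∣ W.conductorNorm ℤ * G.conductorNorm ℤ →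
      NoLocalThreeTorsionAt W ℓ)
    (hunitW : ∀ ℓ ∈ klSet W G, ℓ ≠ 3 → padicValInt 3 (nsCount W ℓ) = 0)
    (hunitG : ∀ ℓ ∈ klSet G W, ℓ ≠ 3 → padicValInt 3 (nsCount G ℓ) = 0)
    (htam : ¬ 3 ∣ W.tamagawaProduct) (htamG : ¬ 3 ∣ G.tamagawaProduct) (hordG : GoodOrd G 3)
    (Gd : WeierstrassCurve ℚ) [Gd.IsElliptic] [Gd.IsGloballyMinimal]
    {N N' : ℕ} [NeZero N] [NeZero N'] (D : ModularParametrizationData W N)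
    (D' : ModularParametrizationData G N')
    (K : Type) [Field K] [NumberField K] (hK : IsImaginaryQuadratic K)
    (hH : SatisfiesHeegnerHypothesis N K) (hH' : SatisfiesHeegnerHypothesis N' K)
    (hKoW : kolyvagin N W K) (hKoG : kolyvagin N' G K) (hGZG : gross_zagier N' G K)
    (hd : NumberField.discr K < -4)
    (hGd : ∃ C : VariableChange ℚ, C • G.quadraticTwist (NumberField.discr K : ℚ) = Gd)
    (htamGd' : Even (NumberField.discr K) → ¬ 3 ∣ Gd.tamagawaProduct)
    (H : HeegnerDatum N (NumberField.discr K)) (H' : HeegnerDatum N' (NumberField.discr K))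
    (ι : K →+* ℂ) (𝔭 : HeightOneSpectrum (𝓞 K)) (h𝔭 : ((3 : ℕ) : 𝓞 K) ∈ 𝔭.asIdeal)
    (he : 𝔭.asIdeal.ramificationIdx (𝓞 ℚ) = 1) (hf : 𝔭.asIdeal.inertiaDeg (𝓞 ℚ) = 1)
    (P : (W.baseChange K).toAffine.Point) (P' : (G.baseChange K).toAffine.Point)
    (hP : WeierstrassCurve.Affine.Point.map ι.toRatAlgHom P = heegnerPointComplex D H)
    (hP' : WeierstrassCurve.Affine.Point.map ι.toRatAlgHom P' = heegnerPointComplex D' H')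
    (hPinf : ¬ IsOfFinAddOrder P) (hP'inf : ¬ IsOfFinAddOrder P')
    (Wt : WeierstrassCurve ℚ) [Wt.IsElliptic]
    (hWt : ∃ C : VariableChange ℚ, C • W.quadraticTwist (NumberField.discr K : ℚ) = Wt)
    (htorst : ¬ 3 ∣ Wt.torsionOrder)
    (hSelW : Nat.card (W.selmerGroup (3 : ℤ)) = 3 ^ W.mordellWeilRank)
    (hSelWt : Nat.card (Wt.selmerGroup (3 : ℤ)) = 3 ^ Wt.mordellWeilRank)
    (hQW : ∃ Q : (W.baseChange K).toAffine.Point, ¬ IsOfFinAddOrder Q ∧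
      X11b.padicLogOrd W 3 (embAt K 3 𝔭 h𝔭 he hf) Q = 0)
    (hcD : padicValInt 3 D.maninConstant = 0) (hc3' : ¬ ((3 : ℤ) ∣ D'.maninConstant)) :
    padicValNat 3 (AddSubgroup.zmultiples P).index = 0 :=
  o5_index_unit_of_ordinary_companion_cited_s0e hKL hPT hEP hYZ hW20 hmod hGZK W G
    (isCongruentModThree_of_torsionIso W G hT) hρ hadd ht3 htℓ hunitW hunitG htam htamG hordG Gd D D' K hK hH hH'
    hKoW hKoG hGZG hd hGd htamGd' H H' ι 𝔭 h𝔭 he hf P P' hP hP' hPinf hP'inf Wt hWt htorst hSelW hSelWt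
    hQW hcD hc3'

/-- **O5 (t′) END OF RECORD in X3E-CERTIFICATE CURRENCY (direct kind)**: `hcong` REPLACED by ONE ROW
`(l, m, u)` of the X3E table — `u ≠ 0`, `𝔠₄(l,m) = u⁴·c₄(G)`, `𝔠₆(l,m) = u⁶·c₆(G)` (two `norm_num`
identities against `Fisher2012.eval_hesseC4three / eval_hesseC6three`) — the companion relation then
rests on NO named fact (Fisher 2012 Thm. 13.2, `n = 3`, proved in the tree). Every other binder verbatim.
[cite: KrizLi2019, Thm. 1.16, Rem. 1.17 (FMS 7 (2019) e15)] [cite: Fisher2012Hessian, Thm. 13.2 (n = 3)] -/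
theorem o5_index_unit_of_ordinary_companion_cited_s0e_x3e
    (hKL : KrizLi2019.thm116_padicLogHeegner_congruence)
    (hPT : ∀ (K : Type) [Field K] [NumberField K], poitouTate_selmerStructure_duality K)
    (hEP : ∀ (K : Type) [Field K] [NumberField K] (v : HeightOneSpectrum (𝓞 K)),
      localEulerPoincareCharacteristic (v.adicCompletion K))
    (hYZ : YanZhu2026.thm415_padicValRat_bsd_rank_le_one)
    (hW20 : Wuthrich2014.lemma20_surjective_threeAdic_of_semistable)
    (hmod : exists_isNewformOf) (hGZK : rank_eq_analyticRank_of_analyticRank_le_one)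
    (W G : WeierstrassCurve ℚ) [W.IsElliptic] [W.IsGloballyMinimal] [G.IsElliptic] [G.IsGloballyMinimal]
    (l m u : ℚ) (hu : u ≠ 0)
    (h4 : MvPolynomial.eval ![l, m] (hesseC4three W.c₄ W.c₆) = u ^ 4 * G.c₄)
    (h6 : MvPolynomial.eval ![l, m] (hesseC6three W.c₄ W.c₆) = u ^ 6 * G.c₆)
    (hρ : W.HasSurjectiveModNGaloisRep 3) (hadd : Addv W 3) (ht3 : NoLocalThreeTorsionAt W 3)
    (htℓ : ∀ (ℓ : ℕ) [Fact ℓ.Prime], ℓ ≠ 3 → (ℓ : ℤ) ∣ W.conductorNorm ℤ * G.conductorNorm ℤ →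
      NoLocalThreeTorsionAt W ℓ)
    (hunitW : ∀ ℓ ∈ klSet W G, ℓ ≠ 3 → padicValInt 3 (nsCount W ℓ) = 0)
    (hunitG : ∀ ℓ ∈ klSet G W, ℓ ≠ 3 → padicValInt 3 (nsCount G ℓ) = 0)
    (htam : ¬ 3 ∣ W.tamagawaProduct) (htamG : ¬ 3 ∣ G.tamagawaProduct) (hordG : GoodOrd G 3)
    (Gd : WeierstrassCurve ℚ) [Gd.IsElliptic] [Gd.IsGloballyMinimal]
    {N N' : ℕ} [NeZero N] [NeZero N'] (D : ModularParametrizationData W N)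
    (D' : ModularParametrizationData G N')
    (K : Type) [Field K] [NumberField K] (hK : IsImaginaryQuadratic K)
    (hH : SatisfiesHeegnerHypothesis N K) (hH' : SatisfiesHeegnerHypothesis N' K)
    (hKoW : kolyvagin N W K) (hKoG : kolyvagin N' G K) (hGZG : gross_zagier N' G K)
    (hd : NumberField.discr K < -4)
    (hGd : ∃ C : VariableChange ℚ, C • G.quadraticTwist (NumberField.discr K : ℚ) = Gd)
    (htamGd' : Even (NumberField.discr K) → ¬ 3 ∣ Gd.tamagawaProduct)
    (H : HeegnerDatum N (NumberField.discr K)) (H' : HeegnerDatum N' (NumberField.discr K))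
    (ι : K →+* ℂ) (𝔭 : HeightOneSpectrum (𝓞 K)) (h𝔭 : ((3 : ℕ) : 𝓞 K) ∈ 𝔭.asIdeal)
    (he : 𝔭.asIdeal.ramificationIdx (𝓞 ℚ) = 1) (hf : 𝔭.asIdeal.inertiaDeg (𝓞 ℚ) = 1)
    (P : (W.baseChange K).toAffine.Point) (P' : (G.baseChange K).toAffine.Point)
    (hP : WeierstrassCurve.Affine.Point.map ι.toRatAlgHom P = heegnerPointComplex D H)
    (hP' : WeierstrassCurve.Affine.Point.map ι.toRatAlgHom P' = heegnerPointComplex D' H')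
    (hPinf : ¬ IsOfFinAddOrder P) (hP'inf : ¬ IsOfFinAddOrder P')
    (Wt : WeierstrassCurve ℚ) [Wt.IsElliptic]
    (hWt : ∃ C : VariableChange ℚ, C • W.quadraticTwist (NumberField.discr K : ℚ) = Wt)
    (htorst : ¬ 3 ∣ Wt.torsionOrder)
    (hSelW : Nat.card (W.selmerGroup (3 : ℤ)) = 3 ^ W.mordellWeilRank)
    (hSelWt : Nat.card (Wt.selmerGroup (3 : ℤ)) = 3 ^ Wt.mordellWeilRank)
    (hQW : ∃ Q : (W.baseChange K).toAffine.Point, ¬ IsOfFinAddOrder Q ∧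
      X11b.padicLogOrd W 3 (embAt K 3 𝔭 h𝔭 he hf) Q = 0)
    (hcD : padicValInt 3 D.maninConstant = 0) (hc3' : ¬ ((3 : ℤ) ∣ D'.maninConstant)) :
    padicValNat 3 (AddSubgroup.zmultiples P).index = 0 :=
  o5_index_unit_of_ordinary_companion_cited_s0e hKL hPT hEP hYZ hW20 hmod hGZK W G
    (isCongruentModThree_of_hesseCertificate W G l m u hu h4 h6) hρ hadd ht3 htℓ hunitW hunitG htam htamG hordG Gd D D' K hK hH hH'
    hKoW hKoG hGZG hd hGd htamGd' H H' ι 𝔭 h𝔭 he hf P P' hP hP' hPinf hP'inf Wt hWt htorst hSelW hSelWt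
    hQW hcD hc3'

/-- **O5 (t′) END OF RECORD in X3E-CERTIFICATE CURRENCY (reverse kind)**: `hcong` REPLACED by one row of
the dual family (`Δ′ = c₄(W)³ − c₆(W)²`: `−𝔇(l,m)/(4Δ′) = u⁴·c₄(G)`, `−𝔠₆(l,m)/(8Δ′²) = u⁶·c₆(G)`; the
anti-symplectic `3`-congruences; `X_E^-(3)` analogue of Thm. 13.2, proved in the tree). Every other
binder verbatim. [cite: KrizLi2019, Thm. 1.16, Rem. 1.17 (FMS 7 (2019) e15)] [cite: Fisher2012Hessian, §13 (analogue of Thm. 13.2 for X_E^-(3))] -/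
theorem o5_index_unit_of_ordinary_companion_cited_s0e_x3eRev
    (hKL : KrizLi2019.thm116_padicLogHeegner_congruence)
    (hPT : ∀ (K : Type) [Field K] [NumberField K], poitouTate_selmerStructure_duality K)
    (hEP : ∀ (K : Type) [Field K] [NumberField K] (v : HeightOneSpectrum (𝓞 K)),
      localEulerPoincareCharacteristic (v.adicCompletion K))
    (hYZ : YanZhu2026.thm415_padicValRat_bsd_rank_le_one)
    (hW20 : Wuthrich2014.lemma20_surjective_threeAdic_of_semistable)
    (hmod : exists_isNewformOf) (hGZK : rank_eq_analyticRank_of_analyticRank_le_one)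
    (W G : WeierstrassCurve ℚ) [W.IsElliptic] [W.IsGloballyMinimal] [G.IsElliptic] [G.IsGloballyMinimal]
    (l m u : ℚ) (hu : u ≠ 0)
    (h4 : -MvPolynomial.eval ![l, m] (hesseD3 W.c₄ W.c₆) / (4 * (W.c₄ ^ 3 - W.c₆ ^ 2)) = u ^ 4 * G.c₄)
    (h6 : -MvPolynomial.eval ![l, m] (hesseC6three W.c₄ W.c₆) / (8 * (W.c₄ ^ 3 - W.c₆ ^ 2) ^ 2) =
      u ^ 6 * G.c₆)
    (hρ : W.HasSurjectiveModNGaloisRep 3) (hadd : Addv W 3) (ht3 : NoLocalThreeTorsionAt W 3)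
    (htℓ : ∀ (ℓ : ℕ) [Fact ℓ.Prime], ℓ ≠ 3 → (ℓ : ℤ) ∣ W.conductorNorm ℤ * G.conductorNorm ℤ →
      NoLocalThreeTorsionAt W ℓ)
    (hunitW : ∀ ℓ ∈ klSet W G, ℓ ≠ 3 → padicValInt 3 (nsCount W ℓ) = 0)
    (hunitG : ∀ ℓ ∈ klSet G W, ℓ ≠ 3 → padicValInt 3 (nsCount G ℓ) = 0)
    (htam : ¬ 3 ∣ W.tamagawaProduct) (htamG : ¬ 3 ∣ G.tamagawaProduct) (hordG : GoodOrd G 3)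
    (Gd : WeierstrassCurve ℚ) [Gd.IsElliptic] [Gd.IsGloballyMinimal]
    {N N' : ℕ} [NeZero N] [NeZero N'] (D : ModularParametrizationData W N)
    (D' : ModularParametrizationData G N')
    (K : Type) [Field K] [NumberField K] (hK : IsImaginaryQuadratic K)
    (hH : SatisfiesHeegnerHypothesis N K) (hH' : SatisfiesHeegnerHypothesis N' K)
    (hKoW : kolyvagin N W K) (hKoG : kolyvagin N' G K) (hGZG : gross_zagier N' G K)
    (hd : NumberField.discr K < -4)
    (hGd : ∃ C : VariableChange ℚ, C • G.quadraticTwist (NumberField.discr K : ℚ) = Gd)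
    (htamGd' : Even (NumberField.discr K) → ¬ 3 ∣ Gd.tamagawaProduct)
    (H : HeegnerDatum N (NumberField.discr K)) (H' : HeegnerDatum N' (NumberField.discr K))
    (ι : K →+* ℂ) (𝔭 : HeightOneSpectrum (𝓞 K)) (h𝔭 : ((3 : ℕ) : 𝓞 K) ∈ 𝔭.asIdeal)
    (he : 𝔭.asIdeal.ramificationIdx (𝓞 ℚ) = 1) (hf : 𝔭.asIdeal.inertiaDeg (𝓞 ℚ) = 1)
    (P : (W.baseChange K).toAffine.Point) (P' : (G.baseChange K).toAffine.Point)
    (hP : WeierstrassCurve.Affine.Point.map ι.toRatAlgHom P = heegnerPointComplex D H)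
    (hP' : WeierstrassCurve.Affine.Point.map ι.toRatAlgHom P' = heegnerPointComplex D' H')
    (hPinf : ¬ IsOfFinAddOrder P) (hP'inf : ¬ IsOfFinAddOrder P')
    (Wt : WeierstrassCurve ℚ) [Wt.IsElliptic]
    (hWt : ∃ C : VariableChange ℚ, C • W.quadraticTwist (NumberField.discr K : ℚ) = Wt)
    (htorst : ¬ 3 ∣ Wt.torsionOrder)
    (hSelW : Nat.card (W.selmerGroup (3 : ℤ)) = 3 ^ W.mordellWeilRank)
    (hSelWt : Nat.card (Wt.selmerGroup (3 : ℤ)) = 3 ^ Wt.mordellWeilRank)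
    (hQW : ∃ Q : (W.baseChange K).toAffine.Point, ¬ IsOfFinAddOrder Q ∧
      X11b.padicLogOrd W 3 (embAt K 3 𝔭 h𝔭 he hf) Q = 0)
    (hcD : padicValInt 3 D.maninConstant = 0) (hc3' : ¬ ((3 : ℤ) ∣ D'.maninConstant)) :
    padicValNat 3 (AddSubgroup.zmultiples P).index = 0 :=
  o5_index_unit_of_ordinary_companion_cited_s0e hKL hPT hEP hYZ hW20 hmod hGZK W G
    (isCongruentModThree_of_dualHesseCertificate W G l m u hu h4 h6) hρ hadd ht3 htℓ hunitW hunitG htam htamG hordG Gd D D' K hK hH hH'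
    hKoW hKoG hGZG hd hGd htamGd' H H' ι 𝔭 h𝔭 he hf P P' hP hP' hPinf hP'inf Wt hWt htorst hSelW hSelWt
    hQW hcD hc3'

end Summit.BirchSwinnertonDyer.Rank1Residual.O5.HeegnerLogTransport

end
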